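import Summits.ResolutionOfSingularities.ResolutionOfSingularities.Theorems.EquisingularLiftEquisingularLiftNatIsoHypPointOfSingularPointsLinAut
import HarnessLib

/-!
# [OURS] THE CLOSED-POINT JACOBIAN DICTIONARY: «`V₊(F)` is regular off the listed points» from the singular VECTORS of `F`
# (cruxes `Theses.EquisingularLift.EquisingularLiftNat` / `…NatThree`, stmt-ResolutionOfSingularities-20038 / -20148; every dimension, every field `K = K̄`)

[OURS · leafhand-res-equisingularlift-10 g1, 2026-08-31; cell `pub/decomp-res`] AI-produced, weaker than expert review; NOT a statement of any manuscript;
nothing here proves resolution of singularities in positive characteristic.  DEF-FREE helper; no `sorry`; standard axioms; ZERO named hypotheses.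

The «remaining classical brick» named by ✓ `…NatIsoHypPointOfPointsLinAut` (p829617) and ✓ `…NatIsoHypPointOfSingularPointsLinAut` (p829768): their
hypothesis `hreg` («`V₊(F)` is regular at every point which is none of the listed ones») is a statement about ALL scheme points of `V₊(F)`, closed or not,
and was left on stalks.  Here it is DERIVED from the hypothesis a geometer actually checks — the common zeros of `F, ∂₀F, …, ∂_N F` in `K^{N+1} ∖ 0` are,
up to scaling, finitely many listed vectors:

* `HypersurfaceSpecimen.exists_chartQuotEquiv_apply` — the chart isomorphism `ChartRing F c ≃+* K[y]/(F(x_c:=1))` with its value on EVERY element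
  (`q ↦ chartAlgEquiv q`), and `chartAlgEquiv_isLocalizationElem` (`G/x_c^e ↦ G(x_c := 1)`);
* ★ `HypersurfaceSpecimen.mem_asHomogeneousIdeal_chart_iff` — **forms through the hypersurface chart**: for `G` homogeneous of positive degree and any point
  `w` of `Spec (ChartRing F c)`, `G ∈ 𝔮_{ι(chart w)} ↔ (G/x_c^e)‾ ∈ 𝔭_w` (Mathlib `Proj.awayι_preimage_basicOpen`, complement form);
* `SingLocus.eval_insertNth_eq`, ★ `SingLocus.singular_insertNth` — the cone vector `z = (a; 1 at c)` over an affine point `a` of the chart `x_c = 1`: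
  `G(z) = G(x_c:=1)(a)`, and if `a` is a singular point of `F(x_c := 1)` then `z` is a singular vector of `F` (the missing partial `∂_c F(z)` by EULER'S
  IDENTITY `Σ xᵢ ∂ᵢF = d·F`, Mathlib `IsHomogeneous.sum_X_mul_pderiv`);
* ★★★ `SingLocus.isRegularLocalRing_stalk_of_singularVectors` — **`F` a prime form over `K = K̄`, `V` a finite set of vectors such that every non-zero
  singular vector of `F` is a multiple of a member of `V`; then `V₊(F)` is regular at every point `x` (closed OR NOT) which is none of the `[v]`, `v ∈ V`**
  («none of»: for each `v` some linear form through `v` misses `𝔮_{ι x}`).  Proof: `x = chart_c w`; if every `∂ⱼ(F(x_c:=1))` lay in the prime `P ⊂ K[y]` of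
  `w`, every zero `a` of `P` would give a singular vector `(a;1)`, so `Z(P) ⊆` the finitely many affine traces of `V`; by the NULLSTELLENSATZ
  (`MvPolynomial.IsPrime.vanishingIdeal_zeroLocus`) `P ⊇ ⋂ 𝔪_a`, so `P = 𝔪_a` is the closed point `[v]` — excluded; hence some `∂ⱼ ∉ P` and Matsumura 14.2
  (✓ `MvPolynomial.isRegularLocalRing_localization_quotient_of_pderiv_notMem`) gives regularity;
* ★★★ `isoHypPoint_of_singularVectors_oneStep_linAut` — ✓ `isoHypPoint_of_singularOneStepPoints_linAut` with `hreg` DISCHARGED: the per-point one-step data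
  `(g, c)` as there, plus the vector Jacobian hypothesis «every non-zero singular vector `b` of `F` satisfies `(linSubst ↑g x_a)(b) = 0`, `a ≠ c`, for some
  listed `(g, c)`» ⟹ `IsoHypPoint K (m+2) V₊(F) ι` — a statement with polynomial hypotheses only.

Honest label: closes no registered stub; it removes the last scheme-theoretic hypothesis from the lh10 capstone.

References: [Hartshorne1977, I Thm. 5.1, I Ex. 5.8, II Prop. 2.5]; [Matsumura1987, Thm. 14.2]; Hilbert's Nullstellensatz (Mathlib) — through the cited
tree files.
-/

set_option linter.dupNamespace false -- mandated namespace `Summit.<Summit>.<Problem>` of this single-conjunct summit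

noncomputable section

open CategoryTheory CategoryTheory.Limits AlgebraicGeometry TopologicalSpace
open MvPolynomial HomogeneousLocalization
open Literature.AlgebraicGeometry.Resolution Literature.AlgebraicGeometry.Motives Literature.AlgebraicGeometry.GroupSchemes
open Literature.AlgebraicGeometry.Motives.SmoothHypersurface Literature.AlgebraicGeometry.Motives.ProjectiveSpace
open AlgebraicGeometry.Scheme.IdealSheafData
open Summit.ResolutionOfSingularities.ResolutionOfSingularities.Cruxes.EquisingularLift.StrataSplit

namespace Summit.ResolutionOfSingularities.ResolutionOfSingularities.Cruxes.EquisingularLiftNat.Sections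

/-! ## §1 Forms through the hypersurface chart -/

namespace HypersurfaceSpecimen

variable (k : Type) [Field k] {n : ℕ} (F : MvPolynomial (Fin (n + 2)) k) {d : ℕ} (hF : F.IsHomogeneous d) (hd : 0 < d)

/-- **`ChartRing F c ≃+* k[y]/(f)` with its value on every element**: `θ (q̄) = (chartAlgEquiv q)‾` (`f = F(x_c := 1)`, `(f)` radical) — the isomorphism of
✓ `exists_chartQuotEquiv`, which recorded only the images of the tautological coordinates. [cite: Hartshorne1977, I Thm. 3.4, II Prop. 2.5] -/
theorem exists_chartQuotEquiv_apply (c : Fin (n + 2)) (f : MvPolynomial (Fin (n + 1)) k) (hf : ProjectiveSpace.dehomogenize k c F = f)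
    (hrad : (Ideal.span {f}).radical = Ideal.span {f}) :
    letI := MvPolynomial.gradedAlgebra (σ := Fin (n + 2)) (R := k)
    letI := ProjBaseChange.algebraBase (R := k) (homogeneousSubmodule (Fin (n + 2)) k) (Submonoid.powers (X c : MvPolynomial (Fin (n + 2)) k))
    ∃ θ : ChartRing F c hF ≃+* (MvPolynomial (Fin (n + 1)) k ⧸ Ideal.span {f}),
      ∀ q, θ (toChartRing F c hF q) = Ideal.Quotient.mk _ (chartAlgEquiv k c q) := by
  letI := MvPolynomial.gradedAlgebra (σ := Fin (n + 2)) (R := k)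
  letI := ProjBaseChange.algebraBase (R := k) (homogeneousSubmodule (Fin (n + 2)) k) (Submonoid.powers (X c : MvPolynomial (Fin (n + 2)) k))
  have h1 : chartAlgEquiv k c (chartEqn F c hF) = ProjectiveSpace.dehomogenize k c F := by
    rw [chartEqn, isLocalizationElem_X]
    exact (chartAlgEquiv k c).apply_symm_apply _
  have hmapspan : (Ideal.span {chartEqn F c hF}).map (chartAlgEquiv k c).toRingEquiv.toRingHom = Ideal.span {f} := by
    rw [Ideal.map_span, Set.image_singleton]
    exact congrArg (fun q => Ideal.span {q}) (h1.trans hf)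
  have hideal : chartIdeal F c hF = Ideal.span {chartEqn F c hF} := by
    have hspan : Ideal.span {chartEqn F c hF} = (Ideal.span {f}).comap (chartAlgEquiv k c).toRingEquiv.toRingHom := by
      rw [← hmapspan]
      exact (Ideal.comap_map_of_bijective (chartAlgEquiv k c).toRingEquiv.toRingHom
        (chartAlgEquiv k c).toRingEquiv.bijective).symm
    rw [chartIdeal, hspan, ← Ideal.comap_radical, hrad]
  have hmap : Ideal.span {f} = (chartIdeal F c hF).map (chartAlgEquiv k c).toRingEquiv.toRingHom := by
    rw [hideal, hmapspan]
  exact ⟨Ideal.quotientEquiv _ _ (chartAlgEquiv k c).toRingEquiv hmap, fun q => Ideal.quotientEquiv_mk _ _ _ _ _⟩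

/-- `chartAlgEquiv (G/x_c^e) = G(x_c := 1)` for `G` homogeneous of degree `e`. [folklore] -/
theorem chartAlgEquiv_isLocalizationElem (c : Fin (n + 2)) {e : ℕ} {G : MvPolynomial (Fin (n + 2)) k}
    (hG : G ∈ homogeneousSubmodule (Fin (n + 2)) k e) :
    letI := MvPolynomial.gradedAlgebra (σ := Fin (n + 2)) (R := k)
    letI := ProjBaseChange.algebraBase (R := k) (homogeneousSubmodule (Fin (n + 2)) k) (Submonoid.powers (X c : MvPolynomial (Fin (n + 2)) k))
    chartAlgEquiv k c (Away.isLocalizationElem (X_mem c) hG) = ProjectiveSpace.dehomogenize k c G := by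
  letI := MvPolynomial.gradedAlgebra (σ := Fin (n + 2)) (R := k)
  letI := ProjBaseChange.algebraBase (R := k) (homogeneousSubmodule (Fin (n + 2)) k) (Submonoid.powers (X c : MvPolynomial (Fin (n + 2)) k))
  rw [isLocalizationElem_X]
  exact (chartAlgEquiv k c).apply_symm_apply _

/-- ★ **Forms through the hypersurface chart**: for `G` homogeneous of positive degree `e` and any point `w` of `Spec (ChartRing F c)`,
`G ∈ 𝔮_{ι(chart w)} ↔ (G/x_c^e)‾ ∈ 𝔭_w` (`chart ≫ ι = Spec(k[x]_{(x_c)} → ChartRing F c) ≫ (D₊(x_c) ↪ ℙ)`, complement of Mathlib `Proj.awayι_preimage_basicOpen`).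
[cite: Hartshorne1977, II Prop. 2.5] -/
theorem mem_asHomogeneousIdeal_chart_iff (c : Fin (n + 2)) {e : ℕ} (he : 0 < e) {G : MvPolynomial (Fin (n + 2)) k}
    (hG : G ∈ homogeneousSubmodule (Fin (n + 2)) k e) :
    letI := MvPolynomial.gradedAlgebra (σ := Fin (n + 2)) (R := k)
    ∀ w : Spec (CommRingCat.of (ChartRing F c hF)),
      G ∈ ((hypersurfaceι F).left ((chart F c hF hd).left w)).asHomogeneousIdeal ↔
        toChartRing F c hF (Away.isLocalizationElem (X_mem c) hG) ∈ w.asIdeal := by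
  letI := MvPolynomial.gradedAlgebra (σ := Fin (n + 2)) (R := k)
  letI := ProjBaseChange.algebraBase (R := k) (homogeneousSubmodule (Fin (n + 2)) k) (Submonoid.powers (X c : MvPolynomial (Fin (n + 2)) k))
  intro w
  have hcomp : (hypersurfaceι F).left ((chart F c hF hd).left w) =
      Proj.awayι (homogeneousSubmodule (Fin (n + 2)) k) (X c) (X_mem c) one_pos
        (Spec.map (CommRingCat.ofHom (toChartRing F c hF).toRingHom) w) :=
    congrArg (fun f => f.base w) (chart_left_comp_ι k F hF hd c)
  rw [hcomp]
  have key := Set.ext_iff.mp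
    (ProjSubscheme.awayι_preimage_zeroLocus (homogeneousSubmodule (Fin (n + 2)) k) (X_mem (R := k) c) one_pos hG he)
    (Spec.map (CommRingCat.ofHom (toChartRing F c hF).toRingHom) w)
  rw [Set.mem_preimage] at key
  change ({G} : Set (MvPolynomial (Fin (n + 2)) k)) ⊆ _ ↔
    ({Away.isLocalizationElem (X_mem c) hG} : Set _) ⊆ ((Ideal.comap (toChartRing F c hF).toRingHom w.asIdeal : Ideal _) : Set _) at key
  rw [Set.singleton_subset_iff, Set.singleton_subset_iff, SetLike.mem_coe, SetLike.mem_coe, Ideal.mem_comap] at key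
  exact key

end HypersurfaceSpecimen

/-! ## §2 Singular vectors and the regularity of `V₊(F)` off finitely many closed points -/

namespace SingLocus

variable (K : Type) [Field K] {m : ℕ} (F : MvPolynomial (Fin (m + 2 + 1)) K) {d : ℕ} (hF : F.IsHomogeneous d)

/-- The cone vector `(a; 1 at c)` is non-zero. [folklore] -/
theorem insertNth_ne_zero (c : Fin (m + 2 + 1)) (a : Fin (m + 2) → K) : Fin.insertNth (α := fun _ => K) c (1 : K) a ≠ 0 := by
  intro h
  have h1 := congrFun h c
  rw [Fin.insertNth_apply_same] at h1
  exact one_ne_zero h1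

/-- **`G(a; 1 at c) = G(x_c := 1)(a)`.** [cite: Hartshorne1977, II Prop. 2.5] -/
theorem eval_insertNth_eq (c : Fin (m + 2 + 1)) (a : Fin (m + 2) → K) (G : MvPolynomial (Fin (m + 2 + 1)) K) :
    eval (Fin.insertNth (α := fun _ => K) c (1 : K) a) G = eval a (ProjectiveSpace.dehomogenize K c G) := by
  have h := ProjectiveSpace.eval_dehomogenize c (Fin.insertNth (α := fun _ => K) c (1 : K) a) (Fin.insertNth_apply_same (α := fun _ => K) c 1 a) G
  simp only [Fin.insertNth_apply_succAbove] at h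
  exact h.symm

include hF in
/-- ★ **A singular point of the chart equation gives a singular vector**: if `a` is a zero of `f = F(x_c := 1)` and of all `∂ⱼ f`, then `z = (a; 1 at c)`
satisfies `F(z) = 0` and `∂ᵢF(z) = 0` for EVERY `i` — the partial `∂_c` by Euler's identity `Σ xᵢ ∂ᵢF = d·F`. [cite: Hartshorne1977, I Ex. 5.8] -/
theorem singular_insertNth (c : Fin (m + 2 + 1)) (a : Fin (m + 2) → K)
    (hf : eval a (ProjectiveSpace.dehomogenize K c F) = 0)
    (hdf : ∀ j, eval a (pderiv j (ProjectiveSpace.dehomogenize K c F)) = 0) :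
    eval (Fin.insertNth (α := fun _ => K) c (1 : K) a) F = 0 ∧ ∀ i, eval (Fin.insertNth (α := fun _ => K) c (1 : K) a) (pderiv i F) = 0 := by
  have hF0 : eval (Fin.insertNth (α := fun _ => K) c (1 : K) a) F = 0 := by rw [eval_insertNth_eq, hf]
  have hsucc : ∀ j, eval (Fin.insertNth (α := fun _ => K) c (1 : K) a) (pderiv (c.succAbove j) F) = 0 := fun j => by
    rw [eval_insertNth_eq, ← ProjectiveSpace.pderiv_dehomogenize, hdf]
  refine ⟨hF0, fun i => ?_⟩
  rcases Fin.eq_self_or_eq_succAbove c i with rfl | ⟨j, rfl⟩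
  · have heuler := congrArg (eval (Fin.insertNth (α := fun _ => K) i (1 : K) a)) hF.sum_X_mul_pderiv
    rw [map_sum, Fin.sum_univ_succAbove _ i, map_nsmul, hF0, smul_zero] at heuler
    simp only [map_mul, eval_X, Fin.insertNth_apply_same, one_mul, hsucc, mul_zero, Finset.sum_const_zero, add_zero] at heuler
    exact heuler
  · exact hsucc j

include hF in
/-- ★★★ **`V₊(F)` IS REGULAR OFF THE SINGULAR VECTORS** (`K = K̄`, every dimension).  `F` a prime form; `V` a finite set of vectors such that every
non-zero `b` with `F(b) = 0`, `∇F(b) = 0` is a multiple of some `v ∈ V`; `x` ANY point of `V₊(F)` (closed or not) such that for each `v ∈ V` some linear form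
vanishing at `v` misses `𝔮_{ι x}` (i.e. `x ≠ [v]`).  Then `𝒪_{V₊(F),x}` is regular.  Chart `x = chart_c w`, prime `P ⊂ K[y]` of `w`; were all `∂ⱼ F(x_c:=1)`
in `P`, every zero of `P` would be (the affine trace of) a listed vector, so by the Nullstellensatz `P ⊇ ⋂_{a ∈ A} 𝔪_a` for a finite `A`, `P = 𝔪_a`, and `x`
would be the excluded closed point `[v]`; hence some `∂ⱼ ∉ P` and Matsumura 14.2 applies.
[OURS] [cite: Hartshorne1977, I Thm. 5.1, I Ex. 5.8] [cite: Matsumura1987, Thm. 14.2] -/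
theorem isRegularLocalRing_stalk_of_singularVectors [IsAlgClosed K] (hFp : Prime F) (V : Finset (Fin (m + 2 + 1) → K))
    (hjac : ∀ b : Fin (m + 2 + 1) → K, b ≠ 0 → eval b F = 0 → (∀ i, eval b (pderiv i F) = 0) → ∃ v ∈ V, ∃ t : K, b = t • v) :
    letI := MvPolynomial.gradedAlgebra (σ := Fin (m + 2 + 1)) (R := K)
    ∀ x : ↥(hypersurface F).left, (∀ v ∈ V, ∃ ℓ : MvPolynomial (Fin (m + 2 + 1)) K,
      ℓ.IsHomogeneous 1 ∧ eval v ℓ = 0 ∧ ℓ ∉ ((hypersurfaceι F).left x).asHomogeneousIdeal) →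
    IsRegularLocalRing ((hypersurface F).left.presheaf.stalk x) := by
  letI := MvPolynomial.gradedAlgebra (σ := Fin (m + 2 + 1)) (R := K)
  intro x hx
  classical
  have hd : 0 < d := ConeN.pos_of_prime_of_isHomogeneous K F hF hFp
  -- the chart through `x`
  obtain ⟨c, hc⟩ := HypersurfaceSpecimen.exists_mem_coordChartOpen ((hypersurfaceι F).left x)
  letI := ProjBaseChange.algebraBase (R := K) (homogeneousSubmodule (Fin (m + 2 + 1)) K)
    (Submonoid.powers (X c : MvPolynomial (Fin (m + 2 + 1)) K))
  have hxr : x ∈ Set.range (chart F c hF hd).left := by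
    rw [range_chart_left]
    exact hc
  obtain ⟨w, rfl⟩ := hxr
  set f := ProjectiveSpace.dehomogenize K c F with hfdef
  have hrad : (Ideal.span {f}).radical = Ideal.span {f} := by
    rcases ProjectiveSpace.irreducible_or_isUnit_dehomogenize (i := c) hF hFp.irreducible with hirr | hu
    · exact ((Ideal.span_singleton_prime hirr.ne_zero).mpr (UniqueFactorizationMonoid.irreducible_iff_prime.mp hirr)).radical
    · rw [Ideal.span_singleton_eq_top.mpr hu, Ideal.radical_top]
  obtain ⟨θ, hθ⟩ := HypersurfaceSpecimen.exists_chartQuotEquiv_apply K F hF c f rfl hrad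
  -- the primes `𝔮' ⊂ K[y]/(f)` and `P ⊂ K[y]` of `w`
  obtain ⟨𝔮', h𝔮'⟩ : ∃ P : Ideal (MvPolynomial (Fin (m + 2)) K ⧸ Ideal.span {f}), P = w.asIdeal.comap θ.symm.toRingHom := ⟨_, rfl⟩
  haveI : 𝔮'.IsPrime := by rw [h𝔮']; exact Ideal.comap_isPrime _ _
  have hmem : ∀ q, q ∈ 𝔮' ↔ θ.symm q ∈ w.asIdeal := fun q => by rw [h𝔮', Ideal.mem_comap]; rfl
  obtain ⟨P, hP⟩ : ∃ P : Ideal (MvPolynomial (Fin (m + 2)) K), P = 𝔮'.comap (Ideal.Quotient.mk (Ideal.span {f})) := ⟨_, rfl⟩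
  haveI hPprime : P.IsPrime := by rw [hP]; exact Ideal.comap_isPrime _ _
  have hfP : f ∈ P := by
    rw [hP, Ideal.mem_comap, Ideal.Quotient.eq_zero_iff_mem.mpr (Ideal.mem_span_singleton_self f)]
    exact zero_mem _
  -- dictionary: a form `G` of positive degree lies in `𝔮_x` iff `G(x_c := 1) ∈ P`
  have hdict : ∀ {e : ℕ}, 0 < e → ∀ {G : MvPolynomial (Fin (m + 2 + 1)) K}, G.IsHomogeneous e →
      (G ∈ ((hypersurfaceι F).left ((chart F c hF hd).left w)).asHomogeneousIdeal ↔ ProjectiveSpace.dehomogenize K c G ∈ P) := by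
    intro e he G hG
    have hG' : G ∈ homogeneousSubmodule (Fin (m + 2 + 1)) K e := (mem_homogeneousSubmodule e G).mpr hG
    rw [HypersurfaceSpecimen.mem_asHomogeneousIdeal_chart_iff K F hF hd c he hG' w, hP, Ideal.mem_comap, hmem,
      ← HypersurfaceSpecimen.chartAlgEquiv_isLocalizationElem K c hG', ← hθ, RingEquiv.symm_apply_apply]
  -- it suffices to find a surviving partial derivative (Matsumura 14.2)
  suffices hex : ∃ j, pderiv j f ∉ P by
    obtain ⟨j, hj⟩ := hex
    have hj' : Ideal.Quotient.mk (Ideal.span {f}) (pderiv j f) ∉ 𝔮' := fun h => hj (by rw [hP, Ideal.mem_comap]; exact h)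
    have hreg : IsRegularLocalRing (Localization.AtPrime 𝔮') :=
      Summit.ResolutionOfSingularities.ResolutionOfSingularities.Theorems.MvPolynomial.isRegularLocalRing_localization_quotient_of_pderiv_notMem
        𝔮' j hj'
    exact HypersurfaceSpecimen.isRegularLocalRing_stalk_chart K F hF hd c w
      (OrdPoint.isRegularLocalRing_localization_of_ringEquiv θ.symm 𝔮' w.asIdeal (fun q => by rw [hmem]) hreg)
  by_contra hall
  push Not at hall
  -- every zero of `P` is the affine trace of a listed vector
  let A : Finset (Fin (m + 2) → K) := (V.filter fun v => v c ≠ 0).image fun v j => v (c.succAbove j) / v c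
  have hZ : MvPolynomial.zeroLocus K P ⊆ (A : Set (Fin (m + 2) → K)) := by
    intro a ha
    rw [MvPolynomial.mem_zeroLocus_iff] at ha
    have ha' : ∀ q ∈ P, eval a q = 0 := fun q hq => ha q hq
    obtain ⟨hF0, hdF⟩ := singular_insertNth K F hF c a (ha' f hfP) (fun j => ha' _ (hall j))
    obtain ⟨v, hvV, t, ht⟩ := hjac _ (insertNth_ne_zero K c a) hF0 hdF
    have h1 := congrFun ht c
    rw [Fin.insertNth_apply_same, Pi.smul_apply, smul_eq_mul] at h1
    have hvc : v c ≠ 0 := by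
      intro h0
      rw [h0, mul_zero] at h1
      exact one_ne_zero h1
    refine Finset.mem_coe.mpr (Finset.mem_image.mpr ⟨v, Finset.mem_filter.mpr ⟨hvV, hvc⟩, ?_⟩)
    funext j
    have h2 := congrFun ht (c.succAbove j)
    rw [Fin.insertNth_apply_succAbove, Pi.smul_apply, smul_eq_mul] at h2
    rw [h2, div_eq_iff hvc, mul_comm t, mul_assoc, ← h1, mul_one]
  -- Nullstellensatz: `P ⊇ ⋂_{a ∈ A} 𝔪_a`, hence `P = 𝔪_a` for some `a ∈ A`
  have hPle : (A.inf fun a => (MvPolynomial.vanishingIdeal K ({a} : Set (Fin (m + 2) → K)) :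
      Ideal (MvPolynomial (Fin (m + 2)) K))) ≤ P := by
    intro q hq
    rw [← MvPolynomial.IsPrime.vanishingIdeal_zeroLocus (K := K) P, MvPolynomial.mem_vanishingIdeal_iff]
    intro a ha
    have hle : (A.inf fun a => (MvPolynomial.vanishingIdeal K ({a} : Set (Fin (m + 2) → K)) : Ideal (MvPolynomial (Fin (m + 2)) K))) ≤
        MvPolynomial.vanishingIdeal K ({a} : Set (Fin (m + 2) → K)) :=
      Finset.inf_le (f := fun a => (MvPolynomial.vanishingIdeal K ({a} : Set (Fin (m + 2) → K)) : Ideal (MvPolynomial (Fin (m + 2)) K)))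
        (Finset.mem_coe.mp (hZ ha))
    have hqa : q ∈ (MvPolynomial.vanishingIdeal K ({a} : Set (Fin (m + 2) → K)) : Ideal (MvPolynomial (Fin (m + 2)) K)) := hle hq
    exact (MvPolynomial.mem_vanishingIdeal_singleton_iff a q).mp hqa
  obtain ⟨a, haA, haP⟩ := (Ideal.IsPrime.inf_le' hPprime).mp hPle
  have hmax : (MvPolynomial.vanishingIdeal K ({a} : Set (Fin (m + 2) → K)) : Ideal (MvPolynomial (Fin (m + 2)) K)).IsMaximal :=
    inferInstance
  have hPeq : P = MvPolynomial.vanishingIdeal K ({a} : Set (Fin (m + 2) → K)) := (hmax.eq_of_le hPprime.ne_top haP).symm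
  -- `a` is the trace of some `v ∈ V`: then `x = [v]`, excluded
  obtain ⟨v, hv, rfl⟩ := Finset.mem_image.mp haA
  obtain ⟨hvV, hvc⟩ := Finset.mem_filter.mp hv
  obtain ⟨ℓ, hℓ1, hℓv, hℓx⟩ := hx v hvV
  apply hℓx
  rw [hdict one_pos hℓ1, hPeq, MvPolynomial.mem_vanishingIdeal_singleton_iff]
  change eval (fun j => v (c.succAbove j) / v c) (ProjectiveSpace.dehomogenize K c ℓ) = 0
  rw [← eval_insertNth_eq]
  have hvec : Fin.insertNth (α := fun _ => K) c (1 : K) (fun j => v (c.succAbove j) / v c) = fun i => (v c)⁻¹ * v i := by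
    funext i
    rcases Fin.eq_self_or_eq_succAbove c i with rfl | ⟨j, rfl⟩
    · rw [Fin.insertNth_apply_same, inv_mul_cancel₀ hvc]
    · rw [Fin.insertNth_apply_succAbove, div_eq_inv_mul]
  rw [hvec]
  have h := ProjectiveSpace.isHomogeneous_aeval_const_mul hℓ1 (v c)⁻¹ v
  change eval (fun i => (v c)⁻¹ * v i) ℓ = (v c)⁻¹ ^ 1 * eval v ℓ at h
  rw [h, hℓv, mul_zero]

/-- `ℓ_a = linSubst B (x_a)` is a linear form. [cite: Hartshorne1977, II Example 7.1.1] -/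
theorem isHomogeneous_one_linSubst_X {N : ℕ} (B : Matrix (Fin (N + 1)) (Fin (N + 1)) K) (a : Fin (N + 1)) :
    (ProjLinAction.linSubst K B (X a)).IsHomogeneous 1 :=
  (mem_homogeneousSubmodule 1 _).mp ((ProjLinAction.linSubst K B).map_mem (ProjectiveSpace.X_mem (R := K) a))

/-- `ℓ_a(θ) = (B θ)_a` for `ℓ_a = linSubst B (x_a)` (Mathlib `Matrix.toMvPolynomial_eval_eq_apply`). [cite: Hartshorne1977, II Example 7.1.1] -/
theorem eval_linSubst_X {N : ℕ} (B : Matrix (Fin (N + 1)) (Fin (N + 1)) K) (θ : Fin (N + 1) → K) (a : Fin (N + 1)) :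
    eval θ (ProjLinAction.linSubst K B (X a)) = (B.mulVec θ) a := by
  rw [ProjLinAction.linSubst_apply, aeval_X, Matrix.toMvPolynomial_eval_eq_apply]

/-- **The vector of the point `α_g⁻¹(P_c)`** is `g⁻¹ e_c`: `ℓ_a(g⁻¹ e_c) = (g g⁻¹ e_c)_a = 0` for `a ≠ c`. [folklore] -/
theorem eval_linSubst_X_vec_eq_zero {N : ℕ} (g : GL (Fin (N + 1)) K) (c a : Fin (N + 1)) (hac : a ≠ c) :
    eval (((g⁻¹ : GL (Fin (N + 1)) K) : Matrix (Fin (N + 1)) (Fin (N + 1)) K).mulVec (Pi.single c (1 : K)))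
      (ProjLinAction.linSubst K (g : Matrix (Fin (N + 1)) (Fin (N + 1)) K) (X a)) = 0 := by
  rw [eval_linSubst_X, Matrix.mulVec_mulVec,
    show (g : Matrix (Fin (N + 1)) (Fin (N + 1)) K) * ((g⁻¹ : GL (Fin (N + 1)) K) : Matrix (Fin (N + 1)) (Fin (N + 1)) K) = 1 from Units.mul_inv g,
    Matrix.one_mulVec, Pi.single_eq_of_ne hac]

/-- **A vector killed by the `ℓ_a`, `a ≠ c`, is a multiple of `g⁻¹ e_c`**: `b = (g b)_c • g⁻¹ e_c`. [folklore] -/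
theorem eq_smul_vec_of_forall_eval_eq_zero {N : ℕ} (g : GL (Fin (N + 1)) K) (c : Fin (N + 1)) (b : Fin (N + 1) → K)
    (h : ∀ a, a ≠ c → eval b (ProjLinAction.linSubst K (g : Matrix (Fin (N + 1)) (Fin (N + 1)) K) (X a)) = 0) :
    b = (((g : Matrix (Fin (N + 1)) (Fin (N + 1)) K).mulVec b) c) •
      (((g⁻¹ : GL (Fin (N + 1)) K) : Matrix (Fin (N + 1)) (Fin (N + 1)) K).mulVec (Pi.single c (1 : K))) := by
  set t := ((g : Matrix (Fin (N + 1)) (Fin (N + 1)) K).mulVec b) c with ht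
  have hgb : (g : Matrix (Fin (N + 1)) (Fin (N + 1)) K).mulVec b = t • Pi.single c (1 : K) := by
    funext a
    by_cases hac : a = c
    · subst hac; rw [Pi.smul_apply, Pi.single_eq_same, smul_eq_mul, mul_one]
    · have h' := h a hac
      rw [eval_linSubst_X] at h'
      rw [h', Pi.smul_apply, Pi.single_eq_of_ne hac, smul_zero]
  calc b = ((((g⁻¹ : GL (Fin (N + 1)) K) : Matrix (Fin (N + 1)) (Fin (N + 1)) K) * (g : Matrix (Fin (N + 1)) (Fin (N + 1)) K))).mulVec b := by
        rw [show ((g⁻¹ : GL (Fin (N + 1)) K) : Matrix (Fin (N + 1)) (Fin (N + 1)) K) * (g : Matrix (Fin (N + 1)) (Fin (N + 1)) K) = 1 from Units.inv_mul g,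
          Matrix.one_mulVec]
    _ = _ := by rw [← Matrix.mulVec_mulVec, hgb, Matrix.mulVec_smul]

end SingLocus

/-! ## §3 The lh10 capstone with polynomial hypotheses only -/

/-- ★★★ **SINGULAR ONE-STEP POINTS IN ARBITRARY POSITION ⟹ `IsoHypPoint`, POLYNOMIAL HYPOTHESES ONLY** (`K = K̄`, every dimension): ✓
`isoHypPoint_of_singularOneStepPoints_linAut` (p829768) with its last scheme-theoretic hypothesis `hreg` («regular off the listed points», all scheme points)
DISCHARGED by `SingLocus.isRegularLocalRing_stalk_of_singularVectors`.  Data: `F` a prime form; a list `pts` of per-point linear coordinates `(g, c)` in which the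
moved equation `linSubst ↑g⁻¹ F` is a prime form of degree `d` carrying seat res-D-pv-013's ONE-STEP datum of multiplicity `μ ≥ 2` at `P_c`; and the VECTOR JACOBIAN
HYPOTHESIS: every `b ≠ 0` with `F(b) = 0`, `∇F(b) = 0` satisfies `ℓ_a(b) = 0` (`ℓ_a = linSubst ↑g (x_a)`, `a ≠ c`) for some listed `(g, c)` — i.e. the singular vectors
are the listed points.  Then `IsoHypPoint K (m+2) V₊(F) ι` (the lead's hypothesis #7, `= PointResolvable`).
[OURS] [cite: Hartshorne1977, I Thm. 5.1, II Example 7.1.1] [cite: Matsumura1987, Thm. 14.2] [cite: StacksProject, Tag 080E] -/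
theorem isoHypPoint_of_singularVectors_oneStep_linAut (K : Type) [Field K] [IsAlgClosed K] {m : ℕ} (F : MvPolynomial (Fin (m + 2 + 1)) K) {d : ℕ}
    (hF : F.IsHomogeneous d) (hFp : Prime F) (pts : List (GL (Fin (m + 2 + 1)) K × Fin (m + 2 + 1)))
    (hone : ∀ gc ∈ pts,
      (ProjLinAction.linSubst K ((gc.1⁻¹ : GL (Fin (m + 2 + 1)) K) : Matrix (Fin (m + 2 + 1)) (Fin (m + 2 + 1)) K) F).IsHomogeneous d ∧
      Prime (ProjLinAction.linSubst K ((gc.1⁻¹ : GL (Fin (m + 2 + 1)) K) : Matrix (Fin (m + 2 + 1)) (Fin (m + 2 + 1)) K) F) ∧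
      ∃ (μ : ℕ) (Φ Ψ : MvPolynomial (Fin (m + 2)) K), 2 ≤ μ ∧ Φ.IsHomogeneous μ ∧ Φ ≠ 0 ∧
        Ψ ∈ Ideal.span (Set.range (X : Fin (m + 2) → MvPolynomial (Fin (m + 2)) K)) ^ (μ + 1) ∧
        ProjectiveSpace.dehomogenize K gc.2 (ProjLinAction.linSubst K ((gc.1⁻¹ : GL (Fin (m + 2 + 1)) K) :
          Matrix (Fin (m + 2 + 1)) (Fin (m + 2 + 1)) K) F) = Φ + Ψ ∧
        ∀ l : Fin (m + 2), ∃ G : MvPolynomial (Fin (m + 2)) K,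
          aeval (fun j => X l * Function.update (X : Fin (m + 2) → MvPolynomial (Fin (m + 2)) K) l 1 j) (Φ + Ψ) = X l ^ μ * G ∧
          ∀ P : Ideal (MvPolynomial (Fin (m + 2)) K), P.IsPrime → (X l : MvPolynomial (Fin (m + 2)) K) ∈ P → G ∈ P → ∃ j, pderiv j G ∉ P)
    (hjac : ∀ b : Fin (m + 2 + 1) → K, b ≠ 0 → eval b F = 0 → (∀ i, eval b (pderiv i F) = 0) →
      ∃ gc ∈ pts, ∀ a : Fin (m + 2 + 1), a ≠ gc.2 →
        eval b (ProjLinAction.linSubst K (gc.1 : Matrix (Fin (m + 2 + 1)) (Fin (m + 2 + 1)) K) (X a)) = 0) :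
    letI := MvPolynomial.gradedAlgebra (σ := Fin (m + 2 + 1)) (R := K)
    IsoHypPoint K (m + 2) (hypersurface F).left (hypersurfaceι F).left := by
  letI := MvPolynomial.gradedAlgebra (σ := Fin (m + 2 + 1)) (R := K)
  classical
  refine isoHypPoint_of_singularOneStepPoints_linAut K F hF hFp pts hone fun x hx => ?_
  let vec : GL (Fin (m + 2 + 1)) K × Fin (m + 2 + 1) → (Fin (m + 2 + 1) → K) := fun gc =>
    ((gc.1⁻¹ : GL (Fin (m + 2 + 1)) K) : Matrix (Fin (m + 2 + 1)) (Fin (m + 2 + 1)) K).mulVec (Pi.single gc.2 (1 : K))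
  refine SingLocus.isRegularLocalRing_stalk_of_singularVectors K F hF hFp (pts.map vec).toFinset ?_ x ?_
  · intro b hb hFb hdFb
    obtain ⟨gc, hgc, hb0⟩ := hjac b hb hFb hdFb
    exact ⟨vec gc, List.mem_toFinset.mpr (List.mem_map.mpr ⟨gc, hgc, rfl⟩),
      ((gc.1 : Matrix (Fin (m + 2 + 1)) (Fin (m + 2 + 1)) K).mulVec b) gc.2, SingLocus.eq_smul_vec_of_forall_eval_eq_zero K gc.1 gc.2 b hb0⟩
  · intro v hv
    obtain ⟨gc, hgc, rfl⟩ := List.mem_map.mp (List.mem_toFinset.mp hv)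
    have hx' := hx gc hgc
    push Not at hx'
    obtain ⟨a, hac, ha⟩ := hx'
    exact ⟨ProjLinAction.linSubst K (gc.1 : Matrix (Fin (m + 2 + 1)) (Fin (m + 2 + 1)) K) (X a),
      SingLocus.isHomogeneous_one_linSubst_X K _ a, SingLocus.eval_linSubst_X_vec_eq_zero K gc.1 gc.2 a hac, ha⟩

end Summit.ResolutionOfSingularities.ResolutionOfSingularities.Cruxes.EquisingularLiftNat.Sections

end
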